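import Literature.MathematicalPhysics.StatisticalMechanics.BarlowCoordination
import HarnessLib

/-!
# Rings of a close-packed Barlow stacking: the distance gap `(a, √2·a)` and the four common
# neighbours of every touching pair (Hales, *Dense Sphere Packings* §1.3) — proved

Topic `Literature/MathematicalPhysics/StatisticalMechanics`; sequel of `BarlowCoordination.lean`
(every point of the ideal stacking `barlowStacking a h s`, `h² = ⅔a²`, `s` a Hägg sequence, has
exactly twelve points of the stacking at distance `a`, and none closer).  Written for the
definition request `defn-IsChargeFree` (route `AtomisticToContinuum/Crystallization/LinkCensus`):
the two facts below are exactly what makes every interior site of a window of a close-packed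
Barlow stacking CHARGE-FREE (`Literature/Geometry/DiscreteGeometry/BondGraph.lean`: twelve bonds,
and ring number four across every bond) at every tolerance `η` with `1 ≤ 1 + η < √2`.

* `eq_or_dist_eq_of_dist_lt` — **the distance gap**: two points of the stacking at distance
  `< √2 · a` coincide or are at distance exactly `a` (the second coordination shell of every
  Barlow packing sits at `√2 · a`: the twelve-coordination form
  `12 · dist² = a² · (3(2P+Q+Λ)² + (3Q+Λ)² + 8K²)` of `BarlowCoordination.lean` takes no value
  strictly between `12` and `24`, `form_eq_zero_or_twelve_of_lt`).
* `ncard_commonTouching_eq_four` — **four common neighbours**: if `u, v` are points of the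
  stacking with `dist u v = a`, exactly four points of the stacking are at distance `a` from both
  (the tangent arrangement around each ball is the cuboctahedron or the anticuboctahedron
  [HalesDSP2012, §1.3; in tree `LayerShellPatterns.hasFccOrHcpShells_barlowStacking`], and in both
  "each point has precisely 4 neighbors" [FlatleyTheil2015, §2.1, after Conjecture 2.2]).  The
  proof is the finite check behind the picture: relative to a centre in layer `k` the twelve
  touching points are `linkOffsets (s (k−1)) (s k)` (relative layer `r ∈ {−1, 0, 1}` and in-layer
  offset, from `BarlowCoordination.touching_eq_union`), two of them touch iff `linkAdj` (the shell
  equations `dist_barlowPos_eq_iff` read in relative coordinates, `dist_relPos_eq_iff_linkAdj`),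
  and
  `card_filter_linkAdj` counts, by `decide`, four solutions for each of the twelve points and each
  of the four letter patterns `(s (k−1), s k) ∈ {±1}²` (fcc-like `ABC` and hcp-like `ABA` centres
  alike).

## References

* T. C. Hales, *Dense Sphere Packings: a blueprint for formal proofs*, LMS LN 400, CUP (2012),
  §1.3 (`HalesDSP2012`).
* L. C. Flatley, F. Theil, *Face-centered cubic crystallization of atomistic configurations*,
  Arch. Ration. Mech. Anal. 218 (2015), arXiv:1407.0692, §2.1 (Conjecture 2.2 and the remark
  following it) (`FlatleyTheil2015`).
* J. H. Conway, N. J. A. Sloane, *Sphere Packings, Lattices and Groups*, 3rd ed. (1999), Ch. 4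
  §6.3 (the shells of `D₃`: squared lengths `2, 4, …`) (`ConwaySloane1999`).
-/

noncomputable section

open Set

namespace Literature.MathematicalPhysics.StatisticalMechanics

/-! ## The distance gap `(a, √2 a)` -/

/-- **Adjacent-layer form**: for a letter shift `σ = ±1`, `3(2P+Q+σ)² + (3Q+σ)²` is `4` or at
least `16` (so across adjacent layers `12·dist²/a² = … + 8` is `12` or `≥ 24`). [folklore] -/
theorem adjLayer_eq_four_or_sixteen_le {P Q σ : ℤ} (hσ : σ = 1 ∨ σ = -1) :
    3 * (2 * P + Q + σ) ^ 2 + (3 * Q + σ) ^ 2 = 4 ∨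
      16 ≤ 3 * (2 * P + Q + σ) ^ 2 + (3 * Q + σ) ^ 2 := by
  by_contra hcon
  push Not at hcon
  obtain ⟨hne, hlt⟩ := hcon
  have hv : (3 * Q + σ) ^ 2 < 4 ^ 2 := by nlinarith [sq_nonneg (2 * P + Q + σ)]
  have hu : (2 * P + Q + σ) ^ 2 < 3 ^ 2 := by nlinarith [sq_nonneg (3 * Q + σ)]
  obtain ⟨hv1, hv2⟩ := abs_lt_of_sq_lt_sq' hv (by norm_num)
  obtain ⟨hu1, hu2⟩ := abs_lt_of_sq_lt_sq' hu (by norm_num)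
  rcases hσ with rfl | rfl
  · have hQ1 : -1 ≤ Q := by omega
    have hQ2 : Q ≤ 0 := by omega
    have hP1 : -2 ≤ P := by omega
    have hP2 : P ≤ 2 := by omega
    interval_cases P <;> interval_cases Q <;> omega
  · have hQ1 : 0 ≤ Q := by omega
    have hQ2 : Q ≤ 1 := by omega
    have hP1 : -2 ≤ P := by omega
    have hP2 : P ≤ 2 := by omega
    interval_cases P <;> interval_cases Q <;> omega

/-- **The twelve-coordination form takes no value in `(12, 24)`** (nor in `(0, 12)`): for a Hägg
sequence, if `3(2P+Q+Λ)² + (3Q+Λ)² + 8K² < 24` (`P = i − i'`, `Q = j − j'`, `K = k − k'`,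
`Λ = L(k) − L(k')`) then the two index triples coincide or the form equals `12`. [folklore] -/
theorem form_eq_zero_or_twelve_of_lt {s : ℤ → ℤ} (hs : IsHaggSeq s) (k i j k' i' j' : ℤ)
    (hF : 3 * (2 * (i - i') + (j - j') + (haggLabel s k - haggLabel s k')) ^ 2 +
        (3 * (j - j') + (haggLabel s k - haggLabel s k')) ^ 2 + 8 * (k - k') ^ 2 < 24) :
    (k, i, j) = (k', i', j') ∨
      3 * (2 * (i - i') + (j - j') + (haggLabel s k - haggLabel s k')) ^ 2 +
        (3 * (j - j') + (haggLabel s k - haggLabel s k')) ^ 2 + 8 * (k - k') ^ 2 = 12 := by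
  set Λ : ℤ := haggLabel s k - haggLabel s k' with hΛ
  have hK2 : (k - k') ^ 2 < 2 ^ 2 := by
    nlinarith [sq_nonneg (2 * (i - i') + (j - j') + Λ), sq_nonneg (3 * (j - j') + Λ)]
  obtain ⟨hK1, hK1'⟩ := abs_lt_of_sq_lt_sq' hK2 (by norm_num)
  rcases (show k' = k + 1 ∨ k' = k ∨ k' = k - 1 by omega) with hk' | hk' | hk'
  · -- next layer: `Λ = -s k`
    right
    have hΛ' : Λ = -s k := by rw [hΛ, hk', haggLabel_sub_haggLabel_succ]
    have hσ : -s k = 1 ∨ -s k = -1 := by rcases hs k with h1 | h1 <;> omega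
    have e8 : 8 * (k - k') ^ 2 = 8 := by rw [hk']; ring
    rw [e8] at hF ⊢
    rw [hΛ'] at hF ⊢
    rcases adjLayer_eq_four_or_sixteen_le (P := i - i') (Q := j - j') hσ with h4 | h16
    · linarith
    · exfalso; linarith
  · -- same layer: `Λ = 0`, the form is `12 (P² + PQ + Q²)`
    have hΛ0 : Λ = 0 := by rw [hΛ, hk', sub_self]
    have e8 : 8 * (k - k') ^ 2 = 0 := by rw [hk']; ring
    rw [e8, hΛ0, add_zero, add_zero, add_zero] at hF ⊢
    by_cases hPQ : (i - i', j - j') = (0, 0)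
    · left
      simp only [Prod.mk.injEq, sub_eq_zero] at hPQ
      rw [hk', hPQ.1, hPQ.2]
    · right
      have h12 := twelve_le_inLayer hPQ
      have hm : 3 * (2 * (i - i') + (j - j')) ^ 2 + (3 * (j - j')) ^ 2 =
          12 * ((i - i') ^ 2 + (i - i') * (j - j') + (j - j') ^ 2) := by ring
      rw [hm] at hF h12 ⊢
      omega
  · -- previous layer: `Λ = s (k - 1)`
    right
    have hΛ' : Λ = s (k - 1) := by rw [hΛ, hk', haggLabel_sub_haggLabel_pred]
    have hσ : s (k - 1) = 1 ∨ s (k - 1) = -1 := hs (k - 1)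
    have e8 : 8 * (k - k') ^ 2 = 8 := by rw [hk']; ring
    rw [e8] at hF ⊢
    rw [hΛ'] at hF ⊢
    rcases adjLayer_eq_four_or_sixteen_le (P := i - i') (Q := j - j') hσ with h4 | h16
    · linarith
    · exfalso; linarith

section Ideal

variable {a h : ℝ} {s : ℤ → ℤ}

/-- **The distance gap of a close-packed Barlow stacking** (parametrised form): two points of the
ideal stacking (`a > 0`, `h² = ⅔a²`, `s` Hägg) at distance `< √2 · a` have the same indices or are
at distance exactly `a`. [cite: HalesDSP2012, §1.3] -/
theorem eq_or_dist_barlowPos_eq_of_lt (hs : IsHaggSeq s) (ha : 0 < a) (hh : h ^ 2 = 2 / 3 * a ^ 2)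
    {k i j k' i' j' : ℤ}
    (hlt : dist (barlowPos a h s k i j) (barlowPos a h s k' i' j') < Real.sqrt 2 * a) :
    (k, i, j) = (k', i', j') ∨ dist (barlowPos a h s k i j) (barlowPos a h s k' i' j') = a := by
  have h12 := twelve_mul_dist_barlowPos_sq hh s k i j k' i' j'
  set F : ℤ := 3 * (2 * (i - i') + (j - j') + (haggLabel s k - haggLabel s k')) ^ 2 +
    (3 * (j - j') + (haggLabel s k - haggLabel s k')) ^ 2 + 8 * (k - k') ^ 2 with hFdef
  have hd0 : 0 ≤ dist (barlowPos a h s k i j) (barlowPos a h s k' i' j') := dist_nonneg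
  have hsq : dist (barlowPos a h s k i j) (barlowPos a h s k' i' j') ^ 2 < 2 * a ^ 2 := by
    have h2 : Real.sqrt 2 ^ 2 = 2 := Real.sq_sqrt (by norm_num)
    have hsa : 0 ≤ Real.sqrt 2 * a := by positivity
    nlinarith [mul_self_lt_mul_self hd0 hlt]
  have hF24 : F < 24 := by
    have ha2 : 0 < a ^ 2 := by positivity
    have hF' : (F : ℝ) < 24 := by
      by_contra hge
      push Not at hge
      nlinarith
    exact_mod_cast hF'
  rcases form_eq_zero_or_twelve_of_lt hs k i j k' i' j' hF24 with h0 | hF12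
  · exact Or.inl h0
  · exact Or.inr ((dist_barlowPos_eq_iff_form ha hh s k i j k' i' j').2 hF12)

/-- **The distance gap of a close-packed Barlow stacking**: two points of `barlowStacking a h s`
(`a > 0`, `h² = ⅔a²`, `s` a Hägg sequence) at distance `< √2 · a` are equal or at distance exactly
`a` — there is no distance strictly between the first shell `a` and the second shell `√2 · a`.
[cite: HalesDSP2012, §1.3] -/
theorem eq_or_dist_eq_of_dist_lt (hs : IsHaggSeq s) (ha : 0 < a) (hh : h ^ 2 = 2 / 3 * a ^ 2)
    {u w : EuclideanSpace ℝ (Fin 3)} (hu : u ∈ barlowStacking a h s) (hw : w ∈ barlowStacking a h s)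
    (hlt : dist u w < Real.sqrt 2 * a) : u = w ∨ dist u w = a := by
  obtain ⟨k, i, j, rfl⟩ := hu
  obtain ⟨k', i', j', rfl⟩ := hw
  rcases eq_or_dist_barlowPos_eq_of_lt hs ha hh hlt with h0 | h1
  · left
    simp only [Prod.mk.injEq] at h0
    rw [h0.1, h0.2.1, h0.2.2]
  · exact Or.inr h1

/-- The form used for soft bonds: two distinct points of the stacking at distance `≤ t` for some
`t < √2 · a` are at distance exactly `a`. [cite: HalesDSP2012, §1.3] -/
theorem dist_eq_of_dist_le_of_lt (hs : IsHaggSeq s) (ha : 0 < a) (hh : h ^ 2 = 2 / 3 * a ^ 2)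
    {u w : EuclideanSpace ℝ (Fin 3)} (hu : u ∈ barlowStacking a h s) (hw : w ∈ barlowStacking a h s) (hne : u ≠ w)
    {t : ℝ} (ht : t < Real.sqrt 2 * a) (hle : dist u w ≤ t) : dist u w = a :=
  (eq_or_dist_eq_of_dist_lt hs ha hh hu hw (hle.trans_lt ht)).resolve_left hne

/-! ## The link of a point in relative coordinates -/

/-- The letter shift seen from relative layer `r` of a centre in layer `k` with
`σm = s (k − 1)`, `σp = s k`: the shift between layers `k + r` and `k + r + 1` is `s (k + r)`,
i.e. `σp` for `r = 0` and `σm` for `r = −1` (junk `0` otherwise; only `r ∈ {−1, 0}` is used).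
[folklore] -/
def letterAt (σm σp r : ℤ) : ℤ := if r = 0 then σp else if r = -1 then σm else 0

/-- **The twelve touching points in relative coordinates**: relative layer `r ∈ {−1, 0, 1}` and
in-layer offset `(P, Q)` — six in the centre's layer (`sixOffsets`), three above
(`threeOffsets (−σp)`), three below (`threeOffsets σm`), as in
`BarlowCoordination.touching_eq_union`. [folklore] -/
def linkOffsets (σm σp : ℤ) : Finset (ℤ × ℤ × ℤ) :=
  (sixOffsets.image fun PQ => ((0 : ℤ), PQ)) ∪
    ((threeOffsets (-σp)).image fun PQ => ((1 : ℤ), PQ)) ∪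
      ((threeOffsets σm).image fun PQ => ((-1 : ℤ), PQ))

/-- **Touching, in relative coordinates**: the shell equations `dist_barlowPos_eq_iff` between the
points with relative coordinates `x = (r, P, Q)` and `y = (r', P', Q')` (an `abbrev`, so that it is
decidable by unfolding). [folklore] -/
abbrev linkAdj (σm σp : ℤ) (x y : ℤ × ℤ × ℤ) : Prop :=
  (y.1 = x.1 ∧ (y.2.1 - x.2.1, y.2.2 - x.2.2) ∈ sixOffsets) ∨
    (y.1 = x.1 + 1 ∧ (y.2.1 - x.2.1, y.2.2 - x.2.2) ∈ threeOffsets (-letterAt σm σp x.1)) ∨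
      (y.1 = x.1 - 1 ∧ (y.2.1 - x.2.1, y.2.2 - x.2.2) ∈ threeOffsets (letterAt σm σp (x.1 - 1)))

/-- There are twelve touching points for each of the four letter patterns (cf.
`BarlowCoordination.ncard_touching_barlowPos`). [cite: HalesDSP2012, §1.3] -/
theorem card_linkOffsets :
    ∀ σm ∈ ({1, -1} : Finset ℤ), ∀ σp ∈ ({1, -1} : Finset ℤ), (linkOffsets σm σp).card = 12 := by
  decide

/-- **The finite check**: for each of the four letter patterns and each of the twelve touching
points `x` of the centre, exactly four of the twelve touch `x` (the cuboctahedron and the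
anticuboctahedron are `4`-regular), i.e. `24` touching pairs among the twelve
(`FlatleyEtAl2013`: the maximum). [cite: FlatleyTheil2015, §2.1] -/
theorem card_filter_linkAdj :
    ∀ σm ∈ ({1, -1} : Finset ℤ), ∀ σp ∈ ({1, -1} : Finset ℤ), ∀ x ∈ linkOffsets σm σp,
      ((linkOffsets σm σp).filter (linkAdj σm σp x)).card = 4 := by
  decide

/-- Relative layers of the touching points are `−1, 0, 1`. [folklore] -/
theorem fst_mem_of_mem_linkOffsets {σm σp : ℤ} {x : ℤ × ℤ × ℤ} (hx : x ∈ linkOffsets σm σp) :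
    x.1 = -1 ∨ x.1 = 0 ∨ x.1 = 1 := by
  simp only [linkOffsets, Finset.mem_union, Finset.mem_image] at hx
  rcases hx with (⟨PQ, -, rfl⟩ | ⟨PQ, -, rfl⟩) | ⟨PQ, -, rfl⟩ <;> simp

/-- The point of the stacking with coordinates `x = (r, P, Q)` relative to the centre
`barlowPos a h s k i j`: `barlowPos a h s (k + r) (i − P) (j − Q)`
(`= offsetPos a h s i j (k + r) (P, Q)`). [folklore] -/
def relPos (a h : ℝ) (s : ℤ → ℤ) (k i j : ℤ) (x : ℤ × ℤ × ℤ) : EuclideanSpace ℝ (Fin 3) :=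
  offsetPos a h s i j (k + x.1) x.2

/-- `relPos` is injective (different layers have different heights, and `offsetPos_injective`
within a layer). [folklore] -/
theorem relPos_injective (ha : 0 < a) (hh : h ^ 2 = 2 / 3 * a ^ 2) (k i j : ℤ) :
    Function.Injective (relPos a h s k i j) := by
  have hh0 : h ≠ 0 := by
    intro h0
    rw [h0] at hh
    nlinarith
  intro x y hxy
  have h1 : k + x.1 = k + y.1 := offsetPos_layer_eq hh0 hxy
  have h1' : x.1 = y.1 := by omega
  unfold relPos at hxy
  rw [h1] at hxy
  have h2 : x.2 = y.2 := offsetPos_injective (h := h) (s := s) ha i j (k + y.1) hxy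
  exact Prod.ext h1' h2

/-- **The shell in relative coordinates**: the points of the stacking at distance `a` from
`barlowPos a h s k i j` are exactly the `relPos` images of `linkOffsets (s (k−1)) (s k)`.
[cite: HalesDSP2012, §1.3] -/
theorem touching_iff_exists_linkOffsets (hs : IsHaggSeq s) (ha : 0 < a)
    (hh : h ^ 2 = 2 / 3 * a ^ 2) (k i j : ℤ) (w : EuclideanSpace ℝ (Fin 3)) :
    (w ∈ barlowStacking a h s ∧ dist (barlowPos a h s k i j) w = a) ↔
      ∃ x ∈ linkOffsets (s (k - 1)) (s k), relPos a h s k i j x = w := by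
  have hTu := Set.ext_iff.1 (touching_eq_union hs ha hh k i j) w
  rw [mem_setOf_eq] at hTu
  rw [hTu]
  simp only [mem_union, mem_image, Finset.mem_coe, linkOffsets, Finset.mem_union, Finset.mem_image]
  constructor
  · rintro (⟨PQ, hPQ, rfl⟩ | ⟨PQ, hPQ, rfl⟩ | ⟨PQ, hPQ, rfl⟩)
    · exact ⟨(0, PQ), Or.inl (Or.inl ⟨PQ, hPQ, rfl⟩), by simp [relPos]⟩
    · exact ⟨(1, PQ), Or.inl (Or.inr ⟨PQ, hPQ, rfl⟩), rfl⟩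
    · exact ⟨(-1, PQ), Or.inr ⟨PQ, hPQ, rfl⟩, by simp [relPos, sub_eq_add_neg]⟩
  · rintro ⟨x, (⟨PQ, hPQ, rfl⟩ | ⟨PQ, hPQ, rfl⟩) | ⟨PQ, hPQ, rfl⟩, rfl⟩
    · exact Or.inl ⟨PQ, hPQ, by simp [relPos]⟩
    · exact Or.inr (Or.inl ⟨PQ, hPQ, rfl⟩)
    · exact Or.inr (Or.inr ⟨PQ, hPQ, by simp [relPos, sub_eq_add_neg]⟩)

/-- **Touching between two points of the shell is `linkAdj`** (for relative layers in
`{−1, 0, 1}`). [folklore] -/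
theorem dist_relPos_eq_iff_linkAdj (hs : IsHaggSeq s) (ha : 0 < a) (hh : h ^ 2 = 2 / 3 * a ^ 2)
    (k i j : ℤ) {x y : ℤ × ℤ × ℤ} (hx : x.1 = -1 ∨ x.1 = 0 ∨ x.1 = 1)
    (hy : y.1 = -1 ∨ y.1 = 0 ∨ y.1 = 1) :
    dist (relPos a h s k i j x) (relPos a h s k i j y) = a ↔ linkAdj (s (k - 1)) (s k) x y := by
  unfold relPos offsetPos
  rw [dist_barlowPos_eq_iff hs ha hh]
  have e1 : (i - x.2.1 - (i - y.2.1), j - x.2.2 - (j - y.2.2)) = (y.2.1 - x.2.1, y.2.2 - x.2.2) := by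
    ext <;> simp only <;> ring
  rw [e1]
  refine or_congr (and_congr_left' (by omega)) (or_congr ?_ ?_)
  · -- next layer: only `x.1 ∈ {-1, 0}` can occur
    rcases hx with hx1 | hx1 | hx1
    · have hl : letterAt (s (k - 1)) (s k) x.1 = s (k + x.1) := by
        rw [letterAt, if_neg (by omega), if_pos hx1, hx1]; ring_nf
      rw [hl]
      exact and_congr_left' (by omega)
    · have hl : letterAt (s (k - 1)) (s k) x.1 = s (k + x.1) := by
        rw [letterAt, if_pos hx1, hx1, add_zero]
      rw [hl]
      exact and_congr_left' (by omega)
    · constructor <;> rintro ⟨h1, -⟩ <;> omega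
  · -- previous layer: only `x.1 ∈ {0, 1}` can occur
    rcases hx with hx1 | hx1 | hx1
    · constructor <;> rintro ⟨h1, -⟩ <;> omega
    · have hl : letterAt (s (k - 1)) (s k) (x.1 - 1) = s (k + x.1 - 1) := by
        rw [letterAt, if_neg (by omega), if_pos (by omega), hx1, add_zero]
      rw [hl]
      exact and_congr_left' (by omega)
    · have hl : letterAt (s (k - 1)) (s k) (x.1 - 1) = s (k + x.1 - 1) := by
        rw [letterAt, if_pos (by omega), hx1]; ring_nf
      rw [hl]
      exact and_congr_left' (by omega)

/-- **Four common neighbours** (the rings of a close-packed Barlow stacking): if `u, v` are points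
of the ideal stacking `barlowStacking a h s` (`a > 0`, `h² = ⅔a²`, `s` Hägg) with `dist u v = a`,
then exactly four points of the stacking are at distance `a` from both `u` and `v` — the tangent
arrangement around `u` is a cuboctahedron or an anticuboctahedron [HalesDSP2012, §1.3], in which
"each point has precisely 4 neighbors" [FlatleyTheil2015, §2.1].
[cite: HalesDSP2012, §1.3] -/
theorem ncard_commonTouching_eq_four (hs : IsHaggSeq s) (ha : 0 < a) (hh : h ^ 2 = 2 / 3 * a ^ 2)
    {u v : EuclideanSpace ℝ (Fin 3)} (hu : u ∈ barlowStacking a h s) (hv : v ∈ barlowStacking a h s)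
    (huv : dist u v = a) :
    {w | w ∈ barlowStacking a h s ∧ dist u w = a ∧ dist v w = a}.ncard = 4 := by
  obtain ⟨k, i, j, rfl⟩ := hu
  have hT := touching_iff_exists_linkOffsets hs ha hh k i j
  obtain ⟨x₁, hx₁, rfl⟩ := (hT v).1 ⟨hv, huv⟩
  have hσm : s (k - 1) ∈ ({1, -1} : Finset ℤ) := by
    rcases hs (k - 1) with h1 | h1 <;> simp [h1]
  have hσp : s k ∈ ({1, -1} : Finset ℤ) := by
    rcases hs k with h1 | h1 <;> simp [h1]
  have hset : {w | w ∈ barlowStacking a h s ∧ dist (barlowPos a h s k i j) w = a ∧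
      dist (relPos a h s k i j x₁) w = a} =
        relPos a h s k i j ''
          ↑((linkOffsets (s (k - 1)) (s k)).filter (linkAdj (s (k - 1)) (s k) x₁)) := by
    ext w
    simp only [mem_setOf_eq, mem_image, Finset.coe_filter]
    constructor
    · rintro ⟨hw, huw, hvw⟩
      obtain ⟨x₂, hx₂, rfl⟩ := (hT w).1 ⟨hw, huw⟩
      exact ⟨x₂, ⟨hx₂, (dist_relPos_eq_iff_linkAdj hs ha hh k i j (fst_mem_of_mem_linkOffsets hx₁)
        (fst_mem_of_mem_linkOffsets hx₂)).1 hvw⟩, rfl⟩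
    · rintro ⟨x₂, ⟨hx₂, hadj⟩, rfl⟩
      obtain ⟨hw, huw⟩ := (hT _).2 ⟨x₂, hx₂, rfl⟩
      exact ⟨hw, huw, (dist_relPos_eq_iff_linkAdj hs ha hh k i j (fst_mem_of_mem_linkOffsets hx₁)
        (fst_mem_of_mem_linkOffsets hx₂)).2 hadj⟩
  rw [hset, Set.ncard_image_of_injective _ (relPos_injective ha hh k i j), Set.ncard_coe_finset]
  exact card_filter_linkAdj _ hσm _ hσp x₁ hx₁

end Ideal

end Literature.MathematicalPhysics.StatisticalMechanics

end
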